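import Literature.AlgebraicGeometry.Frobenioids.ArchimedeanFSMRepaired
import Literature.AlgebraicGeometry.Frobenioids.ArchimedeanFSMRegime
import HarnessLib

/-!
# Frobenioids II, Proposition 3.4 (iii)R / (vi)R: the repaired named statements CLOSED
# (abc-iut cell, layer L1, node `FrdII:Prop3.4(iii)R`, chain LC-L1-2)

Mochizuki, *The geometry of Frobenioids II: poly-Frobenioids*, Kyushu J. Math. **62** (2008)
401–460, §3, Proposition 3.4 (iii), (vi) p. 30. [cite: MochizukiFrdII2008, Prop 3.4 (iii) p.30]

PROOF-ONLY link file: seat abc-iut-L1-t6's named statements `ArchFrd.Prop34_iiiR π`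
(`IsComplexRegime π → Prop34_iii π`) and `ArchFrd.Prop34_viR π` (L1-lead RULING R37, file
`ArchimedeanFSMRegime.lean`) are theorems, by `prop34_iii_of_isComplex` / `prop34_vi_of_isComplex`
(file `ArchimedeanFSMRepaired.lean`). No side is taken on [IUTchIII] Cor. 3.12.
-/

namespace Literature.AlgebraicGeometry.Frobenioids

open CategoryTheory

namespace ArchFrd

universe v u

variable {D : Type u} [Category.{v} D] (π : D ⥤ D0)

/-- **Proposition 3.4 (iii)R holds**: in the complex regime, FSM-morphisms of `F ∈ {A, N, R}` project
to FSM-morphisms of `D`. [cite: MochizukiFrdII2008, Prop 3.4 (iii) p.30] -/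
theorem prop34_iiiR_holds : Prop34_iiiR π := fun hD => prop34_iii_of_isComplex π hD

/-- **Proposition 3.4 (vi)R holds**: in the complex regime, the bundled item (vi) (lifting of
factorizations; irreducible and FSMI clauses) for `F ∈ {A, N, R}`. [cite: MochizukiFrdII2008, Prop 3.4 (vi) p.30] -/
theorem prop34_viR_holds : Prop34_viR π := fun hD => prop34_vi_of_isComplex π hD

end ArchFrd

end Literature.AlgebraicGeometry.Frobenioids
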